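import Literature.AlgebraicGeometry.AbelianSchemes.AbelianSchemeKOfL
import Literature.AlgebraicGeometry.Modules.PicardGroupSheafCohomologyThickening
import Literature.AlgebraicGeometry.Deformation.InvertibleSheafExtensions
import Literature.AlgebraicGeometry.Modules.CechPicToSheafCohomology
import Literature.AlgebraicGeometry.Modules.UnitCocyclePullback
import Literature.AlgebraicGeometry.Deformation.FirstOrderPairUnitsClassShift
import HarnessLib

/-!
# Classes of `(1 × k)^*Λ(L)` for infinitesimal points `k` of an abelian scheme are truncated exponentials
# (Mumford, *Abelian Varieties* §13, proof of the Theorem pp. 126–127; Hartshorne, *Deformation Theory* §6 Thm. 6.4)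

Layer `Literature/AlgebraicGeometry/AbelianSchemes`, namespace `Literature.AlgebraicGeometry.AbelianSchemes.AbelianSchemeOver`.
THEOREMS ONLY (no definition, no named fact, no instance, no notation, no `sorry`).

Setting: `A/S` an abelian scheme, `L` of rank one on `A` rigidified along the zero section (`ε^*[L] = 1`), Mumford's bundle
`Λ(L) = m^*L ⊗ p₁^*L⁻¹ ⊗ p₂^*L⁻¹` on `A ×_S A` (★ `mumfordBundle`, class ★ `mumfordClass`), a morphism `ι₀ : T₀ → T` over `S` such
that `1_A × ι₀ : A_{T₀} → A_T` is a first-order thickening with ideal `𝓘` (★ `IsFirstOrderThickening`, ★ `idealSheafAb`, truncated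
exponential ★ `truncExp : 𝓘 → 𝒪^×_{A_T}`).

* `cechPic_pullback_whiskerLeft_one_mumfordClass` — `(1_A × 1_T)^*[Λ(L)] = 1` (the unit point lies in `K(L)(T)`, ★ `kOfL`).
* `detClassH_pullback_whiskerLeft_mumfordBundle_eq_toH` — the class of `(1 × k)^*Λ(L)` in `H¹(A_T, 𝒪^×)` read on a cocycle `c`
  presenting `[Λ(L)]`.
* **`exists_cocycle_detClassH_pullback_whiskerLeft_mumfordBundle_eq`** — for an INFINITESIMAL point `k : T → A` (`ι₀ ≫ k = 1`) the class
  of `(1 × k)^*Λ(L)` in `H¹(A_T, 𝒪^×)` is `H¹(truncExp)` of the class of an explicit `𝓘`-valued Čech cocycle (values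
  `(1 × k)♯(c)·(1 × 1)♯(c)⁻¹ − 1`): the pair theorem ★ `Deformation.UnitCocycle.exists_toH_pullback_eq_add_map_truncExp` for
  `u₁ = 1 × 1`, `u₂ = 1 × k` (they agree on `A_{T₀}`) and the first bullet.  This is the `(cls, hcls)` input of the Kodaira–Spencer
  count ★ `AbelianSchemeOver.exists_lift_detClassH_eq_add_of_count` ([MumfordAV1970] §13 pp. 126–127, «the liftings of the sheaf
  differ by an element of `H¹(𝒪) ⊗ I`»).

Cell `hodgecm-mathlib` (FLOOR 0), P1 (Mc) N3′ letter S-e, brick K2; author F0P1c-p01 (g0).  PROOF lane, generic capital.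
HC_CM is proved only modulo the 7 printed citations until rung 0 closes; nothing here is about HC.

## References
* [MumfordAV1970] D. Mumford, *Abelian Varieties* (1970), §13, proof of the Theorem (pp. 125–130).
* [Hartshorne2010] R. Hartshorne, *Deformation Theory*, GTM 257 (2010), §6 Thm. 6.4 (b) and its proof (pp. 50–51).
* [Hartshorne1977] R. Hartshorne, *Algebraic Geometry* (1977), III Ex. 4.5 (`Pic = Ȟ¹(𝒪^*)`).
-/

set_option autoImplicit false

noncomputable section

-- `TopCat.Presheaf`/`Scheme.Modules` are not reducible (as in ★ `AbelianSchemeKOfL`).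
set_option backward.isDefEq.respectTransparency false

open CategoryTheory CategoryTheory.Limits AlgebraicGeometry MonoidalCategory CartesianMonoidalCategory
open scoped MonObj

namespace Literature.AlgebraicGeometry.AbelianSchemes

open Literature.AlgebraicGeometry.Motives Literature.AlgebraicGeometry.Modules Literature.AlgebraicGeometry.Deformation

namespace AbelianSchemeOver

section Classes

variable {S : Scheme.{0}} (A : AbelianSchemeOver S) {L : A.left.Modules} (hL : HasRank L 1)
  (hε : CechPic.pullback A.unitSection (detClass (HasRank.isFiniteLocallyFree' hL)) = 1)

include hε in
/-- **`(1_A × 1_T)^*[Λ(L)] = 1`**: the unit `T`-point lies in `K(L)(T)` for `L` rigidified along the identity section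
(★ `kOfL` is a subgroup). [cite: MumfordAV1970, §13 (p. 123)] -/
theorem cechPic_pullback_whiskerLeft_one_mumfordClass (T : Over S) :
    CechPic.pullback (A.X ◁ (1 : T ⟶ A.X)).left (A.mumfordClass (detClass (HasRank.isFiniteLocallyFree' hL))) = 1 :=
  (A.memKOfL_iff_mumfordClass hL (1 : T ⟶ A.X)).1 ((A.mem_kOfL_iff hL hε (1 : T ⟶ A.X)).1 (Subgroup.one_mem _))

/-- **The class of `(1_A × k)^*Λ(L)` in `H¹(A_T, 𝒪^×)` read on a presenting cocycle**: if `c` presents `[Λ(L)]`, then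
`detClassH ((1 × k)^*Λ(L)) = ((1 × k)^*c).toH`. [cite: Hartshorne1977, III Ex. 4.5] -/
theorem detClassH_pullback_whiskerLeft_mumfordBundle_eq_toH {T : Over S} (k : T ⟶ A.X) (c : UnitCocycle (A.X ⊗ A.X).left)
    (hc : CechPic.mk c = A.mumfordClass (detClass (HasRank.isFiniteLocallyFree' hL))) :
    detClassH (HasRank.isFiniteLocallyFree' (hasRank_pullback (A.X ◁ k).left (A.hasRank_mumfordBundle hL))) =
      (UnitCocycle.pullback (A.X ◁ k).left c).toH := by
  have hΛf := HasRank.isFiniteLocallyFree' (A.hasRank_mumfordBundle hL)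
  have e1 : detClass (HasRank.isFiniteLocallyFree' (hasRank_pullback (A.X ◁ k).left (A.hasRank_mumfordBundle hL))) =
      CechPic.pullback (A.X ◁ k).left (detClass hΛf) :=
    (detClass_congr _ (hΛf.pullback (A.X ◁ k).left)).trans (detClass_pullback (A.X ◁ k).left hΛf)
  rw [A.detClass_mumfordBundle hL] at e1
  have e2 : CechPic.pullback (A.X ◁ k).left (A.mumfordClass (detClass (HasRank.isFiniteLocallyFree' hL))) =
      CechPic.mk (UnitCocycle.pullback (A.X ◁ k).left c) := by
    rw [← hc, CechPic.pullback_mk]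
  exact (detClassH_def _).trans ((congrArg (fun y => (CechPic.toSheafH (A.X ⊗ T).left y).toAdd) (e1.trans e2)).trans
    (CechPic.toAdd_toSheafH_mk _))

include hε in
/-- **KODAIRA–SPENCER CLASSES OF INFINITESIMAL POINTS** ([MumfordAV1970] §13 pp. 126–127; [Hartshorne2010] §6 proof of Thm. 6.4).
Let `ι₀ : T₀ → T` over `S` make `1_A × ι₀ : A_{T₀} → A_T` a first-order thickening with ideal `𝓘`, let `c` be a Čech cocycle of
units on `A ×_S A` presenting `[Λ(L)]` (`L` of rank one, rigidified along `ε`), and let `k : T → A` be an INFINITESIMAL point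
(`ι₀ ≫ k = 1`).  Then the class of `(1 × k)^*Λ(L)` in `H¹(A_T, 𝒪^×)` is the truncated exponential of an `𝓘`-valued Čech cocycle
`x` whose values are `(1 × k)♯(c) · (1 × 1)♯(c)⁻¹ − 1` (the difference derivation of `1 × k` and `1 × 1` applied to `dlog c`):
`detClassH ((1 × k)^*Λ(L)) = H¹(truncExp)(q(x))`.  Proof: the pair theorem ★ `UnitCocycle.exists_toH_pullback_eq_add_map_truncExp`
for `u₁ = 1 × 1`, `u₂ = 1 × k` (they agree on `A_{T₀}`), and `[(1 × 1)^*Λ(L)] = 1`.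
[cite: MumfordAV1970, §13 (proof of the Theorem, pp. 125–130)] [cite: Hartshorne2010, §6 Thm. 6.4 (b) with its proof (pp. 50–51)] -/
theorem exists_cocycle_detClassH_pullback_whiskerLeft_mumfordBundle_eq {T₀ T : Over S} (ι₀ : T₀ ⟶ T)
    [IsFirstOrderThickening (A.X ◁ ι₀).left] (c : UnitCocycle (A.X ⊗ A.X).left)
    (hc : CechPic.mk c = A.mumfordClass (detClass (HasRank.isFiniteLocallyFree' hL))) (k : T ⟶ A.X) (hk : ι₀ ≫ k = 1) :
    ∃ x : cechOneCocycles (idealSheafAb (A.X ◁ ι₀).left)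
        (UnitCocycle.mul (UnitCocycle.pullback (A.X ◁ k).left c)
          (UnitCocycle.inv (UnitCocycle.pullback (A.X ◁ (1 : T ⟶ A.X)).left c))).U,
      (∀ a b : ↥((A.X ⊗ T).left),
        idealVal (A.X ◁ ι₀).left _ ((x : CechOneCochain (idealSheafAb (A.X ◁ ι₀).left) _) a b) =
          (UnitCocycle.mul (UnitCocycle.pullback (A.X ◁ k).left c)
            (UnitCocycle.inv (UnitCocycle.pullback (A.X ◁ (1 : T ⟶ A.X)).left c))).g a b _ inf_le_left inf_le_right - 1) ∧
      detClassH (HasRank.isFiniteLocallyFree' (hasRank_pullback (A.X ◁ k).left (A.hasRank_mumfordBundle hL))) =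
        Sheaf.H.map (truncExp (A.X ◁ ι₀).left) 1
          (cechToH (idealSheafAb (A.X ◁ ι₀).left) _
            (UnitCocycle.mul (UnitCocycle.pullback (A.X ◁ k).left c)
              (UnitCocycle.inv (UnitCocycle.pullback (A.X ◁ (1 : T ⟶ A.X)).left c))).iSup_U_eq_top x) := by
  have hu : (A.X ◁ ι₀).left ≫ (A.X ◁ (1 : T ⟶ A.X)).left = (A.X ◁ ι₀).left ≫ (A.X ◁ k).left := by
    rw [← Over.comp_left, ← Over.comp_left, ← MonoidalCategory.whiskerLeft_comp, ← MonoidalCategory.whiskerLeft_comp,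
      MonObj.comp_one, hk]
  obtain ⟨x, hx, hclass⟩ :=
    UnitCocycle.exists_toH_pullback_eq_add_map_truncExp (A.X ◁ ι₀).left (A.X ◁ (1 : T ⟶ A.X)).left (A.X ◁ k).left hu c
  refine ⟨x, hx, ?_⟩
  have h0 : CechPic.mk (UnitCocycle.pullback (A.X ◁ (1 : T ⟶ A.X)).left c) = 1 := by
    rw [← CechPic.pullback_mk, hc, A.cechPic_pullback_whiskerLeft_one_mumfordClass hL hε T]
  have h1 : (UnitCocycle.pullback (A.X ◁ (1 : T ⟶ A.X)).left c).toH = 0 :=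
    (CechPic.toAdd_toSheafH_mk _).symm.trans
      ((congrArg (fun y => (CechPic.toSheafH (A.X ⊗ T).left y).toAdd) h0).trans (by rw [map_one, toAdd_one]))
  exact (A.detClassH_pullback_whiskerLeft_mumfordBundle_eq_toH hL k c hc).trans
    (hclass.trans ((congrArg (· + _) h1).trans (zero_add _)))

end Classes

end AbelianSchemeOver

end Literature.AlgebraicGeometry.AbelianSchemes

end
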